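import Summits.QuantumFields.YangMills.Theorems.BalabanUVNodesN21GappedTopReading13CoPHDefs
import Summits.QuantumFields.YangMills.Theorems.BalabanUVNodesN21GappedTopCut13CoPHRecord
import Summits.QuantumFields.YangMills.Theorems.BalabanUVNodesN21TopLetteredReading13CoPH

/-!
# N21 (NE7c) · THE GAPPED TOP-LETTERED READING `crGap₁₃VAt` — THE FACES: `KeyedExtraction` and `KeyedShellWeight` (with TWO-SIDED collar shells) are THEOREMS on the
# live-selector line, (M1)-FREE; N20 ∕ N19′ ∕ U4′ are witness transfers; the selected letters lie in print's admissible window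

R134 seat `pub-ymgap-dag-n21-d` (g11), node N21 = NE7c (NOT PRINTED; NOT proved at print's fixed thresholds), strategy s2; lane K3⁷ `SpineGivenEndpointR13SepCoPH`
(stmt-QuantumFields-20544, `--supports … --as helper`; COUNT-NEUTRAL).  Imports U5 `…GappedTopReading13CoPHDefs` (the reading), U4 `…GappedTopCut13CoPHRecord` (through it U2∕U3:
`topGapShellAt_nonneg`, `topGapShellAt_le_topClassWeightAt`, `sum_range_sum_topGapShell_le`) and R2 `…TopLetteredReading13CoPH` (p609807: `topTermAtLevel_nonneg`,
`sum_topTermAtLevel_eq_schemeZ_of_liveSel`; S2's `argmin_badness_bounds`; n20-d's canonical-weight transfers `shellWeightBound_wshInf ∕ relWeightBound_wInf ∕ core_deltaCan ∕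
summable_deltaCan ∕ wInf_add_wshInf_lt_one`).

WHAT THIS FILE PROVES (theorems only; 0 `def`, 0 `sorry`).
* §38 level lemmas: `topGapShellAtLevel_nonneg ∕ _le` (at the run's top, rows), ★★ `sum_range_sum_topGapShellAtLevel_le_of_liveSel` (`Σ_{i<m} Σ_s gapShell_j(θ_{i+2},θ_{i+1},θ_i) ≤
  2(2L^m)⁴ · schemeZ … p.K t`, level `0`: no shell; level `k+1`: U3 + dag-n19-d's E1).
* §39 at the reading: ★★ `gapShellSum_selGapDepth_le` (BOTH runs' collar-shell masses at the selected depth `≤ (4(2L^m)⁴∕(n+1)) ×` the runs' partition functions), fibre sums,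
  E1∕E2 at the gapped carriers, ★★★ `shellWeightBound_carriersGap₁₃` — `ShellWeightBound 1 (classSet₁₃ …) (gapWeightA₁₃ …) (gapWeightB₁₃ …) (gapShellA₁₃ …) (gapShellB₁₃ …)
  (K ↦ 4(2L^m)⁴·(1∕(n_K+1)))`, every field PROVED — ★★★ `shellWeightBound_crGap₁₃VAt` (at the reading with its CANONICAL `Wsh`), ★★ `keyedExtraction_crGap₁₃VAt` (THEOREM for every
  `g₀`), transfers `relWeightBound_crGap₁₃VAt ∕ core_crGap₁₃VAt ∕ lt_one_crGap₁₃VAt`, windows `selGapLettersA_mem_window ∕ selGapLettersB_mem_window` (the three letters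
  `θ_{i⋆+2} ≤ θ_{i⋆+1} ≤ θ_{i⋆}` lie in `[ε(1−ρ_K)^{n_K+2}, ε]`).
ROWS (displayed, nothing else): the live-selector pin `hsel`, (H-ζ) `hζm`, `0 ≤ ρ_K ≤ 1`, `0 ≤ ε_top` for both runs and every `K`, `Summable (K ↦ 1∕(n_K+1))`.

HONEST FRAMING (binding).  Bookkeeping BY NAME over this seat's U1–U5, R1∕R2, T1–T3, def-T FILE 19 and n20-d's reading ∕ canonical weights; NO estimate of Bałaban's; NO
anti-concentration; the reading is NOT the K3 skeleton's `PinnedAtLive` pin (plan's decision — LOCATED); only the top step's (2.17)∕(3.2) factor family is re-lettered (the (3.3)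
family and everything below the top are print's ∕ the record's — LOCATED); the common-refinement comparison of design (i) is the consumer's (N19′ ∕ U5); no `Provisos₁₃CoPH`
inhabitant claimed (K0⁷ open); NE7c NOT PRINTED ∕ NOT proved at print's thresholds; N21 NOT discharged; K3⁷ NOT claimed; counts UNMOVED (typed 28∕28 · discharged 5∕27); never a
count claim.  No `instance`, no `notation`, no `def`.  One finite four-torus programme at fixed `ε` — NOT ℝ⁴, NOT OS, NOT a mass gap, NOT the Clay problem.
-/

noncomputable section

open scoped BigOperators
open Finset MeasureTheory

namespace Summit.QuantumFields.YangMills.Theorems.N21ShellSplitOfRecord13CoPH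

open Literature.MathematicalPhysics.QuantumFieldTheory.Balaban1983to89
open Literature.MathematicalPhysics.QuantumFieldTheory.Balaban1983to89.T4Continuum
open Literature.MathematicalPhysics.QuantumFieldTheory.Balaban1983to89.Node00
open YMDAG.UVSplit (SpineReading₁₃CoPH keyA₁₃ keyB₁₃ runA₁₃ runB₁₃ histA₁₃ histB₁₃ histA₁₃_zero histB₁₃_zero classSet₁₃ badClass₁₃)
open T4WeightBudget (RelWeightBound)
open T4IndicatorShell (ShellWeightBound)
open T4ContinuumYM4Torus (ForSmallCouplings)
open Summit.QuantumFields.BalabanUV.T4Continuum.Spine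
open Summit.QuantumFields.YangMills.BalabanUVNodes.SpineCanonicalWeights
open Summit.QuantumFields.YangMills.Theorems.N21StepWeightsPositivity (zetaOfRecord_nonneg)
open Summit.QuantumFields.YangMills.BalabanUVNodes.N19MGFFormAtRecordMass (sum_classWeightOfDatum₉_datumOfRecord₁₃CoPH_eq_schemeZ_of_ppSelLive)
open Summit.QuantumFields.YangMills.BalabanUVNodes.N19MGFFormAtRecord (wOfRecord₉_nonneg)

/-! ## §38 Level lemmas -/

section LevelFacts

variable (F : T4Family) (N : ℕ) [NeZero N] (ϑ : Stage9Params F N) (D : FiniteEpsData F (SU N)) (g₀ : ℕ → ℝ) (os : List (ULoop F))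
  (p : B12.RunParams) (g : ℕ → ℝ)

/-- `0 ≤` the two-sided collar shell at every level, AT THE RUN's TOP `j = p.K`, for ordered letters `θlo ≤ θ ≤ θhi` (rows `0 ≤ ζ`, `Σ|ζ| ≤ 1`, (H-ζ), (e1) below the top).
[bookkeeping] -/
theorem topGapShellAtLevel_nonneg (hζ0 : ∀ p g k s Pl Ql RS U V', 0 ≤ ϑ.ζ p g k s Pl Ql RS U V') (hζm : ZetaMeasurable F N ϑ.ζ) (hζ1 : IsZetaAbsLeOne F N ϑ.ν ϑ.τ9.M ϑ.ζ)
    {θlo θ θhi : ℝ} (hlo : θlo ≤ θ) (hhi : θ ≤ θhi) (t : ℝ)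
    (hint : ∀ k, k < p.K → ∀ s : SeqOfRecord F ϑ.ν ϑ.τ9.M g p.K k,
      Integrable (fun U => chiSeqOfRecord F N ϑ.ν ϑ.τ9.M g p.K k s U * dressedSlotsOfDatum₉ F N ϑ D g₀ os t p g k s U) (fieldMeasure (F.P p.K) k (SU N))) :
    ∀ (j : ℕ), j = p.K → ∀ s : SeqOfRecord F ϑ.ν ϑ.τ9.M g p.K j, 0 ≤ topGapShellAtLevel F N ϑ D g₀ os p g θlo θ θhi t j s
  | 0, _, _ => le_rfl
  | k + 1, hk, s' => topGapShellAt_nonneg F N ϑ D g₀ os p g k hk hζ0 hζm hζ1 hlo hhi t (hint k (by omega)) s'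

/-- the two-sided collar shell never exceeds the top-lettered term (the gapped core is `≥ 0`; `0 ≤ ζ` only). [bookkeeping] -/
theorem topGapShellAtLevel_le (hζ0 : ∀ p g k s Pl Ql RS U V', 0 ≤ ϑ.ζ p g k s Pl Ql RS U V') (θlo θ θhi t : ℝ) :
    ∀ (j : ℕ) (s : SeqOfRecord F ϑ.ν ϑ.τ9.M g p.K j), topGapShellAtLevel F N ϑ D g₀ os p g θlo θ θhi t j s ≤ topTermAtLevel F N ϑ D g₀ os p g θ t j s
  | 0, s => classWeightOfDatum₉_nonneg' F N ϑ D g₀ os p g 0 (wOfRecord₉_nonneg ϑ hζ0 p g) t s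
  | k + 1, s' => topGapShellAt_le_topClassWeightAt F N ϑ D g₀ os p g k hζ0 θlo θ θhi t s'

end LevelFacts

section LevelLive

variable {F : T4Family} {N : ℕ} [NeZero N]

/-- ★★ **THE TWO-SIDED PIGEONHOLE AT THE RUN's TOP, AGAINST THE PARTITION FUNCTION** (`j = p.K`; `0 ≤ ρ ≤ 1`, `0 ≤ ε_j`):
`Σ_{i<m} Σ_s gapShell_j(θ_{i+2}, θ_{i+1}, θ_i) ≤ 2(2L^m)⁴ · schemeZ … p.K t` — level `0`: no shell; level `k+1`: U3's `sum_range_sum_topGapShell_le` + dag-n19-d's E1 at level `k`.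
[bookkeeping] -/
theorem sum_range_sum_topGapShellAtLevel_le_of_liveSel (θ : Stage13HParams F N) (hP : θ.Provisos₁₃CoPH F N) (E : B12.RunParams → ℝ)
    (hsel : θ.ppSel = ppSelLiveOfRecord F N θ.ν θ.τ9 E (wOfRecord₉ F N θ.toStage9Params)) (hζm : ZetaMeasurable F N θ.ζ) (g₀ : ℕ → ℝ) (os : List (ULoop F))
    {p : B12.RunParams} {g : ℕ → ℝ} (hg : g 0 = g₀ p.K) {ρ : ℝ} (hρ0 : 0 ≤ ρ) (hρ1 : ρ ≤ 1) (m : ℕ) (t : ℝ) :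
    ∀ j : ℕ, j = p.K → 0 ≤ epsOfRecord θ.ν g j → ∑ i ∈ Finset.range m, ∑ s, topGapShellAtLevel F N θ.toStage9Params (datumOfRecord₁₃CoPH F N θ hP) g₀ os p g
        (cutGrid θ.ν g j ρ (i + 2)) (cutGrid θ.ν g j ρ (i + 1)) (cutGrid θ.ν g j ρ i) t j s ≤
      2 * (2 * (F.L : ℝ) ^ F.m) ^ 4 * T4GenFunBounds.schemeZ ((datumOfRecord₁₃CoPH F N θ hP).scheme g₀) os p.K t := by
  have hζ0 : ∀ p g k s Pl Ql RS U V', 0 ≤ θ.ζ p g k s Pl Ql RS U V' :=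
    fun p g k s Pl Ql RS U V' => zetaOfRecord_nonneg F N θ.ν θ.τ9.M hP.zetaUnity hP.zetaAbs p g k s Pl Ql RS U V'
  have hU : LocalBgMeasurable F N θ.ν := localBgMeasurable F N θ.ν
  have hD : (datumOfRecord₁₃CoPH F N θ hP).AvgMeasurable := (isPrintedAveraged_datumOfRecord₁₃CoPH F N θ hP).avgMeasurable
  have hZ0 : 0 ≤ T4GenFunBounds.schemeZ ((datumOfRecord₁₃CoPH F N θ hP).scheme g₀) os p.K t := by
    rw [← sum_classWeightOfDatum₉_datumOfRecord₁₃CoPH_eq_schemeZ_of_ppSelLive θ hP E hsel hU hζm hζ0 g₀ os hg t 0 (Nat.zero_le _)]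
    exact Finset.sum_nonneg fun s _ => classWeightOfDatum₉_nonneg' F N θ.toStage9Params (datumOfRecord₁₃CoPH F N θ hP) g₀ os p g 0
      (wOfRecord₉_nonneg θ.toStage9Params hζ0 p g) t s
  intro j hj hε
  cases j with
  | zero =>
    simp only [topGapShellAtLevel_zero, Finset.sum_const_zero]
    exact mul_nonneg (by positivity) hZ0
  | succ k =>
    simp only [topGapShellAtLevel_succ]
    rw [← sum_classWeightOfDatum₉_datumOfRecord₁₃CoPH_eq_schemeZ_of_ppSelLive θ hP E hsel hU hζm hζ0 g₀ os hg t k (by omega)]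
    exact sum_range_sum_topGapShell_le F N θ.toStage9Params (datumOfRecord₁₃CoPH F N θ hP) g₀ os p g k hj hζ0 hζm hP.zetaAbs hP.zetaUnity hε hρ0 hρ1 m t
      (fun s => integrable_chi_mul_dressedSlots_of_ppSelLive θ.toStage9Params E hsel hU hζm hζ0 hP.zetaAbs _ hD g₀ os hg t k s)

end LevelLive

/-! ## §39 At the gapped reading: the argmin bound, fibre sums, (R), `ShellWeightBound`, `KeyedExtraction`, transfers, windows -/

section AtReading

variable {F : T4Family} {N : ℕ} [NeZero N]

/-- ★★ **BOTH RUNS' COLLAR-SHELL MASSES AT THE SELECTED DEPTH ARE `≤ (4(2L^m)⁴∕(n+1)) ×` THE RUNS' PARTITION FUNCTIONS** (§38's pigeonhole in each run + the argmin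
`selGapDepth₁₃`); rows `hsel`, (H-ζ), `0 ≤ ρ_K ≤ 1`, both tops' `ε ≥ 0`; NO anti-concentration. [bookkeeping] -/
theorem gapShellSum_selGapDepth_le (K₀ : ℕ) (θ : Stage13HParams F N) (hP : θ.Provisos₁₃CoPH F N) (g₀ : ℕ → ℝ) (os : List (ULoop F)) (E : B12.RunParams → ℝ)
    (hsel : θ.ppSel = ppSelLiveOfRecord F N θ.ν θ.τ9 E (wOfRecord₉ F N θ.toStage9Params)) (hζm : ZetaMeasurable F N θ.ζ)
    {ρ : ℕ → ℝ} (hρ0 : ∀ K, 0 ≤ ρ K) (hρ1 : ∀ K, ρ K ≤ 1) (n K : ℕ) (t : ℝ) (hεA : 0 ≤ epsOfRecord θ.ν (histA₁₃ θ K₀ g₀ K) (K₀ + K))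
    (hεB : 0 ≤ epsOfRecord θ.ν (histB₁₃ θ K₀ g₀ K) (K₀ + K + 1)) :
    gapShellSumA₁₃ θ hP K₀ g₀ os ρ K (selGapDepth₁₃ θ hP K₀ g₀ os ρ n K t) t ≤
        4 * (2 * (F.L : ℝ) ^ F.m) ^ 4 / (n + 1 : ℕ) * T4GenFunBounds.schemeZ ((datumOfRecord₁₃CoPH F N θ hP).scheme g₀) os (K₀ + K) t ∧
      gapShellSumB₁₃ θ hP K₀ g₀ os ρ K (selGapDepth₁₃ θ hP K₀ g₀ os ρ n K t) t ≤
        4 * (2 * (F.L : ℝ) ^ F.m) ^ 4 / (n + 1 : ℕ) * T4GenFunBounds.schemeZ ((datumOfRecord₁₃CoPH F N θ hP).scheme g₀) os (K₀ + K + 1) t := by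
  have hζ0 : ∀ p g k s Pl Ql RS U V', 0 ≤ θ.ζ p g k s Pl Ql RS U V' :=
    fun p g k s Pl Ql RS U V' => zetaOfRecord_nonneg F N θ.ν θ.τ9.M hP.zetaUnity hP.zetaAbs p g k s Pl Ql RS U V'
  have hU : LocalBgMeasurable F N θ.ν := localBgMeasurable F N θ.ν
  have hD : (datumOfRecord₁₃CoPH F N θ hP).AvgMeasurable := (isPrintedAveraged_datumOfRecord₁₃CoPH F N θ hP).avgMeasurable
  -- the two partition functions are nonnegative (E1 at level 0)
  have hZ : ∀ (p : B12.RunParams) (g : ℕ → ℝ), g 0 = g₀ p.K → 0 ≤ T4GenFunBounds.schemeZ ((datumOfRecord₁₃CoPH F N θ hP).scheme g₀) os p.K t := by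
    intro p g hg
    rw [← sum_classWeightOfDatum₉_datumOfRecord₁₃CoPH_eq_schemeZ_of_ppSelLive θ hP E hsel hU hζm hζ0 g₀ os hg t 0 (Nat.zero_le _)]
    exact Finset.sum_nonneg fun s _ => classWeightOfDatum₉_nonneg' F N θ.toStage9Params (datumOfRecord₁₃CoPH F N θ hP) g₀ os p g 0
      (wOfRecord₉_nonneg θ.toStage9Params hζ0 p g) t s
  have hfA := sum_range_sum_topGapShellAtLevel_le_of_liveSel θ hP E hsel hζm g₀ os (p := runA₁₃ F K₀ g₀ K) (histA₁₃_zero θ K₀ g₀ K) (hρ0 K) (hρ1 K) (n + 1) t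
    (K₀ + K) rfl hεA
  have hfB := sum_range_sum_topGapShellAtLevel_le_of_liveSel θ hP E hsel hζm g₀ os (p := runB₁₃ F K₀ g₀ K) (histB₁₃_zero θ K₀ g₀ K) (hρ0 K) (hρ1 K) (n + 1) t
    (K₀ + K + 1) rfl hεB
  have hstepA : ∀ i, cutGrid θ.ν (histA₁₃ θ K₀ g₀ K) (K₀ + K) (ρ K) (i + 1) ≤ cutGrid θ.ν (histA₁₃ θ K₀ g₀ K) (K₀ + K) (ρ K) i :=
    fun i => cutGrid_succ_le_of_nonneg θ.ν (K₀ + K) hεA (hρ0 K) (hρ1 K) i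
  have hstepB : ∀ i, cutGrid θ.ν (histB₁₃ θ K₀ g₀ K) (K₀ + K + 1) (ρ K) (i + 1) ≤ cutGrid θ.ν (histB₁₃ θ K₀ g₀ K) (K₀ + K + 1) (ρ K) i :=
    fun i => cutGrid_succ_le_of_nonneg θ.ν (K₀ + K + 1) hεB (hρ0 K) (hρ1 K) i
  have hintA : ∀ k, k < (runA₁₃ F K₀ g₀ K).K → ∀ s : SeqOfRecord F θ.ν θ.τ9.M (histA₁₃ θ K₀ g₀ K) (runA₁₃ F K₀ g₀ K).K k,
      Integrable (fun U => chiSeqOfRecord F N θ.ν θ.τ9.M (histA₁₃ θ K₀ g₀ K) (runA₁₃ F K₀ g₀ K).K k s U *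
        dressedSlotsOfDatum₉ F N θ.toStage9Params (datumOfRecord₁₃CoPH F N θ hP) g₀ os t (runA₁₃ F K₀ g₀ K) (histA₁₃ θ K₀ g₀ K) k s U)
        (fieldMeasure (F.P (runA₁₃ F K₀ g₀ K).K) k (SU N)) :=
    fun k _ s => integrable_chi_mul_dressedSlots_of_ppSelLive θ.toStage9Params E hsel hU hζm hζ0 hP.zetaAbs _ hD g₀ os (histA₁₃_zero θ K₀ g₀ K) t k s
  have hintB : ∀ k, k < (runB₁₃ F K₀ g₀ K).K → ∀ s : SeqOfRecord F θ.ν θ.τ9.M (histB₁₃ θ K₀ g₀ K) (runB₁₃ F K₀ g₀ K).K k,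
      Integrable (fun U => chiSeqOfRecord F N θ.ν θ.τ9.M (histB₁₃ θ K₀ g₀ K) (runB₁₃ F K₀ g₀ K).K k s U *
        dressedSlotsOfDatum₉ F N θ.toStage9Params (datumOfRecord₁₃CoPH F N θ hP) g₀ os t (runB₁₃ F K₀ g₀ K) (histB₁₃ θ K₀ g₀ K) k s U)
        (fieldMeasure (F.P (runB₁₃ F K₀ g₀ K).K) k (SU N)) :=
    fun k _ s => integrable_chi_mul_dressedSlots_of_ppSelLive θ.toStage9Params E hsel hU hζm hζ0 hP.zetaAbs _ hD g₀ os (histB₁₃_zero θ K₀ g₀ K) t k s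
  have hA0 : ∀ i, 0 ≤ gapShellSumA₁₃ θ hP K₀ g₀ os ρ K i t := fun i => Finset.sum_nonneg fun s _ =>
    topGapShellAtLevel_nonneg F N θ.toStage9Params (datumOfRecord₁₃CoPH F N θ hP) g₀ os (runA₁₃ F K₀ g₀ K) (histA₁₃ θ K₀ g₀ K) hζ0 hζm hP.zetaAbs
      (hstepA (i + 1)) (hstepA i) t hintA (K₀ + K) rfl s
  have hB0 : ∀ i, 0 ≤ gapShellSumB₁₃ θ hP K₀ g₀ os ρ K i t := fun i => Finset.sum_nonneg fun s' _ =>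
    topGapShellAtLevel_nonneg F N θ.toStage9Params (datumOfRecord₁₃CoPH F N θ hP) g₀ os (runB₁₃ F K₀ g₀ K) (histB₁₃ θ K₀ g₀ K) hζ0 hζm hP.zetaAbs
      (hstepB (i + 1)) (hstepB i) t hintB (K₀ + K + 1) rfl s'
  have hspec := selGapDepth₁₃_spec θ hP K₀ g₀ os ρ n K t
  obtain ⟨h₁, h₂⟩ := argmin_badness_bounds (f := fun i => gapShellSumA₁₃ θ hP K₀ g₀ os ρ K i t) (g := fun i => gapShellSumB₁₃ θ hP K₀ g₀ os ρ K i t) hA0 hB0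
    (hZ (runA₁₃ F K₀ g₀ K) _ (histA₁₃_zero θ K₀ g₀ K)) (hZ (runB₁₃ F K₀ g₀ K) _ (histB₁₃_zero θ K₀ g₀ K)) (by positivity) hfA hfB hspec.1 hspec.2
  refine ⟨h₁.trans (le_of_eq ?_), h₂.trans (le_of_eq ?_)⟩
  · rw [YMDAG.UVSplit.runA₁₃_K]; ring
  · rw [YMDAG.UVSplit.runB₁₃_K]; ring

/-- run A: the class-set sum of the gapped weights is the full sum of the top-lettered terms at the selected middle letter. [bookkeeping] -/
theorem sum_classSet₁₃_gapWeightA₁₃ (K₀ : ℕ) (θ : Stage13HParams F N) (hP : θ.Provisos₁₃CoPH F N) (g₀ : ℕ → ℝ) (os : List (ULoop F)) (ρ : ℕ → ℝ) (n : ℕ → ℕ)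
    (K : ℕ) (t : ℝ) :
    ∑ x ∈ classSet₁₃ θ K₀ g₀ K, gapWeightA₁₃ θ hP K₀ g₀ os ρ n K t x =
      ∑ s, topTermAtLevel F N θ.toStage9Params (datumOfRecord₁₃CoPH F N θ hP) g₀ os (runA₁₃ F K₀ g₀ K) (histA₁₃ θ K₀ g₀ K)
        (cutGrid θ.ν (histA₁₃ θ K₀ g₀ K) (K₀ + K) (ρ K) (selGapDepth₁₃ θ hP K₀ g₀ os ρ (n K) K t + 1)) t (K₀ + K) s := by
  letI : ∀ Kc, DecidableEq (SiteSeqKey F Kc) := fun _ => Classical.decEq _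
  exact Finset.sum_fiberwise_of_maps_to (s := Finset.univ) (t := classSet₁₃ θ K₀ g₀ K) (g := keyA₁₃ θ K₀ g₀ K)
    (fun s _ => Finset.mem_union_left _ (Finset.mem_image_of_mem _ (Finset.mem_univ s))) _

/-- run B: the same along `keyB₁₃`. [bookkeeping] -/
theorem sum_classSet₁₃_gapWeightB₁₃ (K₀ : ℕ) (θ : Stage13HParams F N) (hP : θ.Provisos₁₃CoPH F N) (g₀ : ℕ → ℝ) (os : List (ULoop F)) (ρ : ℕ → ℝ) (n : ℕ → ℕ)
    (K : ℕ) (t : ℝ) :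
    ∑ x ∈ classSet₁₃ θ K₀ g₀ K, gapWeightB₁₃ θ hP K₀ g₀ os ρ n K t x =
      ∑ s', topTermAtLevel F N θ.toStage9Params (datumOfRecord₁₃CoPH F N θ hP) g₀ os (runB₁₃ F K₀ g₀ K) (histB₁₃ θ K₀ g₀ K)
        (cutGrid θ.ν (histB₁₃ θ K₀ g₀ K) (K₀ + K + 1) (ρ K) (selGapDepth₁₃ θ hP K₀ g₀ os ρ (n K) K t + 1)) t (K₀ + K + 1) s' := by
  letI : ∀ Kc, DecidableEq (SiteSeqKey F Kc) := fun _ => Classical.decEq _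
  exact Finset.sum_fiberwise_of_maps_to (s := Finset.univ) (t := classSet₁₃ θ K₀ g₀ K) (g := keyB₁₃ θ K₀ g₀ K)
    (fun s' _ => Finset.mem_union_right _ (Finset.mem_image_of_mem _ (Finset.mem_univ s'))) _

/-- run A: the class-set sum of the gapped shell parts is the run's collar-shell mass at the selected depth. [bookkeeping] -/
theorem sum_classSet₁₃_gapShellA₁₃ (K₀ : ℕ) (θ : Stage13HParams F N) (hP : θ.Provisos₁₃CoPH F N) (g₀ : ℕ → ℝ) (os : List (ULoop F)) (ρ : ℕ → ℝ) (n : ℕ → ℕ)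
    (K : ℕ) (t : ℝ) :
    ∑ x ∈ classSet₁₃ θ K₀ g₀ K, gapShellA₁₃ θ hP K₀ g₀ os ρ n K t x = gapShellSumA₁₃ θ hP K₀ g₀ os ρ K (selGapDepth₁₃ θ hP K₀ g₀ os ρ (n K) K t) t := by
  letI : ∀ Kc, DecidableEq (SiteSeqKey F Kc) := fun _ => Classical.decEq _
  exact Finset.sum_fiberwise_of_maps_to (s := Finset.univ) (t := classSet₁₃ θ K₀ g₀ K) (g := keyA₁₃ θ K₀ g₀ K)
    (fun s _ => Finset.mem_union_left _ (Finset.mem_image_of_mem _ (Finset.mem_univ s))) _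

/-- run B: the same. [bookkeeping] -/
theorem sum_classSet₁₃_gapShellB₁₃ (K₀ : ℕ) (θ : Stage13HParams F N) (hP : θ.Provisos₁₃CoPH F N) (g₀ : ℕ → ℝ) (os : List (ULoop F)) (ρ : ℕ → ℝ) (n : ℕ → ℕ)
    (K : ℕ) (t : ℝ) :
    ∑ x ∈ classSet₁₃ θ K₀ g₀ K, gapShellB₁₃ θ hP K₀ g₀ os ρ n K t x = gapShellSumB₁₃ θ hP K₀ g₀ os ρ K (selGapDepth₁₃ θ hP K₀ g₀ os ρ (n K) K t) t := by
  letI : ∀ Kc, DecidableEq (SiteSeqKey F Kc) := fun _ => Classical.decEq _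
  exact Finset.sum_fiberwise_of_maps_to (s := Finset.univ) (t := classSet₁₃ θ K₀ g₀ K) (g := keyB₁₃ θ K₀ g₀ K)
    (fun s' _ => Finset.mem_union_right _ (Finset.mem_image_of_mem _ (Finset.mem_univ s'))) _

/-- ★ **E1 AT THE GAPPED READING**: run A's gapped class weights sum over the class set to the run's dressed partition function (rows `hsel`, (H-ζ)). [bookkeeping] -/
theorem sum_classSet₁₃_gapWeightA₁₃_eq_schemeZ (K₀ : ℕ) (θ : Stage13HParams F N) (hP : θ.Provisos₁₃CoPH F N) (g₀ : ℕ → ℝ) (os : List (ULoop F))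
    (E : B12.RunParams → ℝ) (hsel : θ.ppSel = ppSelLiveOfRecord F N θ.ν θ.τ9 E (wOfRecord₉ F N θ.toStage9Params)) (hζm : ZetaMeasurable F N θ.ζ)
    (ρ : ℕ → ℝ) (n : ℕ → ℕ) (K : ℕ) (t : ℝ) :
    ∑ x ∈ classSet₁₃ θ K₀ g₀ K, gapWeightA₁₃ θ hP K₀ g₀ os ρ n K t x = T4GenFunBounds.schemeZ ((datumOfRecord₁₃CoPH F N θ hP).scheme g₀) os (K₀ + K) t := by
  rw [sum_classSet₁₃_gapWeightA₁₃]
  exact sum_topTermAtLevel_eq_schemeZ_of_liveSel θ hP E hsel hζm g₀ os (p := runA₁₃ F K₀ g₀ K) (histA₁₃_zero θ K₀ g₀ K) _ t (K₀ + K) rfl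

/-- ★ **E2 AT THE GAPPED READING**: run B's. [bookkeeping] -/
theorem sum_classSet₁₃_gapWeightB₁₃_eq_schemeZ (K₀ : ℕ) (θ : Stage13HParams F N) (hP : θ.Provisos₁₃CoPH F N) (g₀ : ℕ → ℝ) (os : List (ULoop F))
    (E : B12.RunParams → ℝ) (hsel : θ.ppSel = ppSelLiveOfRecord F N θ.ν θ.τ9 E (wOfRecord₉ F N θ.toStage9Params)) (hζm : ZetaMeasurable F N θ.ζ)
    (ρ : ℕ → ℝ) (n : ℕ → ℕ) (K : ℕ) (t : ℝ) :
    ∑ x ∈ classSet₁₃ θ K₀ g₀ K, gapWeightB₁₃ θ hP K₀ g₀ os ρ n K t x = T4GenFunBounds.schemeZ ((datumOfRecord₁₃CoPH F N θ hP).scheme g₀) os (K₀ + K + 1) t := by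
  rw [sum_classSet₁₃_gapWeightB₁₃]
  exact sum_topTermAtLevel_eq_schemeZ_of_liveSel θ hP E hsel hζm g₀ os (p := runB₁₃ F K₀ g₀ K) (histB₁₃_zero θ K₀ g₀ K) _ t (K₀ + K + 1) rfl

/-- ★★★ **N21's OUTPUT SHAPE AT THE GAPPED CARRIERS — BOTH SIDES OF THE CUT BANDED, (M1)-FREE.**  At a `CoPH`-keyed Stage-13 tuple on the live-selector line (`hsel`), under
(H-ζ), with the letter rows `0 ≤ ρ_K ≤ 1`, `0 ≤ ε_top` (both runs, every `K`) and `Summable (K ↦ 1∕(n_K+1))`: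
`ShellWeightBound 1 (classSet₁₃ θ K₀ g₀) (gapWeightA₁₃ …) (gapWeightB₁₃ …) (gapShellA₁₃ …) (gapShellB₁₃ …) (K ↦ 4(2L^m)⁴·(1∕(n_K+1)))` — every field PROVED; NO anti-concentration,
NO estimate of Bałaban's. [bookkeeping] -/
theorem shellWeightBound_carriersGap₁₃ (K₀ : ℕ) (θ : Stage13HParams F N) (hP : θ.Provisos₁₃CoPH F N) (g₀ : ℕ → ℝ) (os : List (ULoop F)) (E : B12.RunParams → ℝ)
    (hsel : θ.ppSel = ppSelLiveOfRecord F N θ.ν θ.τ9 E (wOfRecord₉ F N θ.toStage9Params)) (hζm : ZetaMeasurable F N θ.ζ)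
    {ρ : ℕ → ℝ} {n : ℕ → ℕ} (hρ0 : ∀ K, 0 ≤ ρ K) (hρ1 : ∀ K, ρ K ≤ 1) (hεA : ∀ K, 0 ≤ epsOfRecord θ.ν (histA₁₃ θ K₀ g₀ K) (K₀ + K))
    (hεB : ∀ K, 0 ≤ epsOfRecord θ.ν (histB₁₃ θ K₀ g₀ K) (K₀ + K + 1)) (hn : Summable (fun K => 1 / ((n K : ℝ) + 1))) :
    ShellWeightBound 1 (classSet₁₃ θ K₀ g₀) (gapWeightA₁₃ θ hP K₀ g₀ os ρ n) (gapWeightB₁₃ θ hP K₀ g₀ os ρ n) (gapShellA₁₃ θ hP K₀ g₀ os ρ n)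
      (gapShellB₁₃ θ hP K₀ g₀ os ρ n) (fun K => 4 * (2 * (F.L : ℝ) ^ F.m) ^ 4 * (1 / ((n K : ℝ) + 1))) := by
  have hζ0 : ∀ p g k s Pl Ql RS U V', 0 ≤ θ.ζ p g k s Pl Ql RS U V' :=
    fun p g k s Pl Ql RS U V' => zetaOfRecord_nonneg F N θ.ν θ.τ9.M hP.zetaUnity hP.zetaAbs p g k s Pl Ql RS U V'
  have hU : LocalBgMeasurable F N θ.ν := localBgMeasurable F N θ.ν
  have hD : (datumOfRecord₁₃CoPH F N θ hP).AvgMeasurable := (isPrintedAveraged_datumOfRecord₁₃CoPH F N θ hP).avgMeasurable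
  have hνbar : 0 ≤ 4 * (2 * (F.L : ℝ) ^ F.m) ^ 4 := by positivity
  have hconst : ∀ K, 4 * (2 * (F.L : ℝ) ^ F.m) ^ 4 / (n K + 1 : ℕ) = 4 * (2 * (F.L : ℝ) ^ F.m) ^ 4 * (1 / ((n K : ℝ) + 1)) := fun K => by
    push_cast
    ring
  have hstepA : ∀ K i, cutGrid θ.ν (histA₁₃ θ K₀ g₀ K) (K₀ + K) (ρ K) (i + 1) ≤ cutGrid θ.ν (histA₁₃ θ K₀ g₀ K) (K₀ + K) (ρ K) i :=
    fun K i => cutGrid_succ_le_of_nonneg θ.ν (K₀ + K) (hεA K) (hρ0 K) (hρ1 K) i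
  have hstepB : ∀ K i, cutGrid θ.ν (histB₁₃ θ K₀ g₀ K) (K₀ + K + 1) (ρ K) (i + 1) ≤ cutGrid θ.ν (histB₁₃ θ K₀ g₀ K) (K₀ + K + 1) (ρ K) i :=
    fun K i => cutGrid_succ_le_of_nonneg θ.ν (K₀ + K + 1) (hεB K) (hρ0 K) (hρ1 K) i
  have hintA : ∀ K k, k < (runA₁₃ F K₀ g₀ K).K → ∀ s : SeqOfRecord F θ.ν θ.τ9.M (histA₁₃ θ K₀ g₀ K) (runA₁₃ F K₀ g₀ K).K k, ∀ t : ℝ,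
      Integrable (fun U => chiSeqOfRecord F N θ.ν θ.τ9.M (histA₁₃ θ K₀ g₀ K) (runA₁₃ F K₀ g₀ K).K k s U *
        dressedSlotsOfDatum₉ F N θ.toStage9Params (datumOfRecord₁₃CoPH F N θ hP) g₀ os t (runA₁₃ F K₀ g₀ K) (histA₁₃ θ K₀ g₀ K) k s U)
        (fieldMeasure (F.P (runA₁₃ F K₀ g₀ K).K) k (SU N)) :=
    fun K k _ s t => integrable_chi_mul_dressedSlots_of_ppSelLive θ.toStage9Params E hsel hU hζm hζ0 hP.zetaAbs _ hD g₀ os (histA₁₃_zero θ K₀ g₀ K) t k s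
  have hintB : ∀ K k, k < (runB₁₃ F K₀ g₀ K).K → ∀ s : SeqOfRecord F θ.ν θ.τ9.M (histB₁₃ θ K₀ g₀ K) (runB₁₃ F K₀ g₀ K).K k, ∀ t : ℝ,
      Integrable (fun U => chiSeqOfRecord F N θ.ν θ.τ9.M (histB₁₃ θ K₀ g₀ K) (runB₁₃ F K₀ g₀ K).K k s U *
        dressedSlotsOfDatum₉ F N θ.toStage9Params (datumOfRecord₁₃CoPH F N θ hP) g₀ os t (runB₁₃ F K₀ g₀ K) (histB₁₃ θ K₀ g₀ K) k s U)
        (fieldMeasure (F.P (runB₁₃ F K₀ g₀ K).K) k (SU N)) :=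
    fun K k _ s t => integrable_chi_mul_dressedSlots_of_ppSelLive θ.toStage9Params E hsel hU hζm hζ0 hP.zetaAbs _ hD g₀ os (histB₁₃_zero θ K₀ g₀ K) t k s
  letI : ∀ Kc, DecidableEq (SiteSeqKey F Kc) := fun _ => Classical.decEq _
  refine
    { nonneg := fun K => mul_nonneg hνbar (by positivity)
      summable := hn.mul_left _
      sh_nonneg_left := fun K t _ x _ => Finset.sum_nonneg fun s _ =>
        topGapShellAtLevel_nonneg F N θ.toStage9Params (datumOfRecord₁₃CoPH F N θ hP) g₀ os (runA₁₃ F K₀ g₀ K) (histA₁₃ θ K₀ g₀ K) hζ0 hζm hP.zetaAbs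
          (hstepA K _) (hstepA K _) t (fun k hk s => hintA K k hk s t) (K₀ + K) rfl s
      sh_le_left := fun K t _ x _ => Finset.sum_le_sum fun s _ =>
        topGapShellAtLevel_le F N θ.toStage9Params (datumOfRecord₁₃CoPH F N θ hP) g₀ os (runA₁₃ F K₀ g₀ K) (histA₁₃ θ K₀ g₀ K) hζ0 _ _ _ t (K₀ + K) s
      sh_nonneg_right := fun K t _ x _ => Finset.sum_nonneg fun s' _ =>
        topGapShellAtLevel_nonneg F N θ.toStage9Params (datumOfRecord₁₃CoPH F N θ hP) g₀ os (runB₁₃ F K₀ g₀ K) (histB₁₃ θ K₀ g₀ K) hζ0 hζm hP.zetaAbs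
          (hstepB K _) (hstepB K _) t (fun k hk s => hintB K k hk s t) (K₀ + K + 1) rfl s'
      sh_le_right := fun K t _ x _ => Finset.sum_le_sum fun s' _ =>
        topGapShellAtLevel_le F N θ.toStage9Params (datumOfRecord₁₃CoPH F N θ hP) g₀ os (runB₁₃ F K₀ g₀ K) (histB₁₃ θ K₀ g₀ K) hζ0 _ _ _ t (K₀ + K + 1) s'
      left := fun K t _ => ?_
      right := fun K t _ => ?_ }
  · rw [sum_classSet₁₃_gapShellA₁₃, sum_classSet₁₃_gapWeightA₁₃_eq_schemeZ K₀ θ hP g₀ os E hsel hζm, ← hconst K]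
    exact (gapShellSum_selGapDepth_le K₀ θ hP g₀ os E hsel hζm hρ0 hρ1 (n K) K t (hεA K) (hεB K)).1
  · rw [sum_classSet₁₃_gapShellB₁₃, sum_classSet₁₃_gapWeightB₁₃_eq_schemeZ K₀ θ hP g₀ os E hsel hζm, ← hconst K]
    exact (gapShellSum_selGapDepth_le K₀ θ hP g₀ os E hsel hζm hρ0 hρ1 (n K) K t (hεA K) (hεB K)).2

/-- ★★★ **`KeyedShellWeight` AT THE GAPPED TOP-LETTERED READING, BOTH SIDES OF THE CUT, (M1)-FREE**: on the live-selector line, under (H-ζ), with `0 ≤ ρ_K ≤ 1`, `0 ≤ ε_top` and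
`Σ_K 1∕(n_K+1) < ∞` read at the tuple: `ShellWeightBound` AT `crGap₁₃VAt N K₀ jcut ρ n` — its `l₀, T, A, B, shA, shB` and its CANONICAL `Wsh` (n20-d's `shellWeightBound_wshInf`).
`jcut` is not read. [bookkeeping] -/
theorem shellWeightBound_crGap₁₃VAt (K₀ : ℕ) (jcut : ℕ → ℕ) (ρ : WidthLetter₁₃CoPH N) (n : DepthLetter₁₃CoPH N) (θ : Stage13HParams F N) (hP : θ.Provisos₁₃CoPH F N)
    (g₀ : ℕ → ℝ) (os : List (ULoop F)) (E : B12.RunParams → ℝ) (hsel : θ.ppSel = ppSelLiveOfRecord F N θ.ν θ.τ9 E (wOfRecord₉ F N θ.toStage9Params))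
    (hζm : ZetaMeasurable F N θ.ζ) (hρ0 : ∀ K, 0 ≤ ρ F θ hP g₀ os K) (hρ1 : ∀ K, ρ F θ hP g₀ os K ≤ 1)
    (hεA : ∀ K, 0 ≤ epsOfRecord θ.ν (histA₁₃ θ K₀ g₀ K) (K₀ + K)) (hεB : ∀ K, 0 ≤ epsOfRecord θ.ν (histB₁₃ θ K₀ g₀ K) (K₀ + K + 1))
    (hn : Summable (fun K => 1 / ((n F θ hP g₀ os K : ℝ) + 1))) :
    ShellWeightBound (crGap₁₃VAt N K₀ jcut ρ n F θ hP g₀ os).l₀ (crGap₁₃VAt N K₀ jcut ρ n F θ hP g₀ os).T (crGap₁₃VAt N K₀ jcut ρ n F θ hP g₀ os).A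
      (crGap₁₃VAt N K₀ jcut ρ n F θ hP g₀ os).B (crGap₁₃VAt N K₀ jcut ρ n F θ hP g₀ os).shA (crGap₁₃VAt N K₀ jcut ρ n F θ hP g₀ os).shB
      (crGap₁₃VAt N K₀ jcut ρ n F θ hP g₀ os).Wsh :=
  shellWeightBound_wshInf (shellWeightBound_carriersGap₁₃ K₀ θ hP g₀ os E hsel hζm hρ0 hρ1 hεA hεB hn)

/-- ★★ **`KeyedExtraction` AT THE GAPPED READING IS A THEOREM** (the K3 skeleton's shape): `0 < l₀`, `0 < vol = (2L^m)⁴`, and E1 ∕ E2 for EVERY `g₀` (a fortiori `ForSmallCouplings`)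
— rows `hsel`, (H-ζ). [bookkeeping] -/
theorem keyedExtraction_crGap₁₃VAt (K₀ : ℕ) (jcut : ℕ → ℕ) (ρ : WidthLetter₁₃CoPH N) (n : DepthLetter₁₃CoPH N) (θ : Stage13HParams F N) (hP : θ.Provisos₁₃CoPH F N)
    (E : B12.RunParams → ℝ) (hsel : θ.ppSel = ppSelLiveOfRecord F N θ.ν θ.τ9 E (wOfRecord₉ F N θ.toStage9Params)) (hζm : ZetaMeasurable F N θ.ζ) :
    ForSmallCouplings (datumOfRecord₁₃CoPH F N θ hP) fun g₀ => ∀ os : List (ULoop F),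
      0 < (crGap₁₃VAt N K₀ jcut ρ n F θ hP g₀ os).l₀ ∧ 0 < (crGap₁₃VAt N K₀ jcut ρ n F θ hP g₀ os).vol ∧
      (∀ (K : ℕ) (t : ℝ), |t| ≤ (crGap₁₃VAt N K₀ jcut ρ n F θ hP g₀ os).l₀ →
        T4GenFunBounds.schemeZ ((datumOfRecord₁₃CoPH F N θ hP).scheme g₀) os ((crGap₁₃VAt N K₀ jcut ρ n F θ hP g₀ os).K₀ + K) t =
          ∑ τ ∈ (crGap₁₃VAt N K₀ jcut ρ n F θ hP g₀ os).T K, (crGap₁₃VAt N K₀ jcut ρ n F θ hP g₀ os).A K t τ) ∧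
      (∀ (K : ℕ) (t : ℝ), |t| ≤ (crGap₁₃VAt N K₀ jcut ρ n F θ hP g₀ os).l₀ →
        T4GenFunBounds.schemeZ ((datumOfRecord₁₃CoPH F N θ hP).scheme g₀) os ((crGap₁₃VAt N K₀ jcut ρ n F θ hP g₀ os).K₀ + K + 1) t =
          ∑ τ ∈ (crGap₁₃VAt N K₀ jcut ρ n F θ hP g₀ os).T K, (crGap₁₃VAt N K₀ jcut ρ n F θ hP g₀ os).B K t τ) :=
  ForSmallCouplings.of_forall fun g₀ os =>
    ⟨one_pos, pow_pos F.side_pos 4, fun K t _ => (sum_classSet₁₃_gapWeightA₁₃_eq_schemeZ K₀ θ hP g₀ os E hsel hζm _ _ K t).symm,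
      fun K t _ => (sum_classSet₁₃_gapWeightB₁₃_eq_schemeZ K₀ θ hP g₀ os E hsel hζm _ _ K t).symm⟩

/-- ★ **N20 AT THE GAPPED READING FROM ANY WITNESS** (transfer; no estimate). [bookkeeping] -/
theorem relWeightBound_crGap₁₃VAt (K₀ : ℕ) (jcut : ℕ → ℕ) (ρ : WidthLetter₁₃CoPH N) (n : DepthLetter₁₃CoPH N) (θ : Stage13HParams F N) (hP : θ.Provisos₁₃CoPH F N)
    (g₀ : ℕ → ℝ) (os : List (ULoop F)) {W : ℕ → ℝ}
    (h : RelWeightBound 1 (classSet₁₃ θ K₀ g₀) (gapWeightA₁₃ θ hP K₀ g₀ os (ρ F θ hP g₀ os) (n F θ hP g₀ os)) (gapWeightB₁₃ θ hP K₀ g₀ os (ρ F θ hP g₀ os) (n F θ hP g₀ os))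
      (badClass₁₃ θ K₀ g₀ jcut) W) :
    RelWeightBound (crGap₁₃VAt N K₀ jcut ρ n F θ hP g₀ os).l₀ (crGap₁₃VAt N K₀ jcut ρ n F θ hP g₀ os).T (crGap₁₃VAt N K₀ jcut ρ n F θ hP g₀ os).A
      (crGap₁₃VAt N K₀ jcut ρ n F θ hP g₀ os).B (crGap₁₃VAt N K₀ jcut ρ n F θ hP g₀ os).Bad (crGap₁₃VAt N K₀ jcut ρ n F θ hP g₀ os).W :=
  relWeightBound_wInf h

/-- ★ **N19′'s CORE AND U4′'s SUMMABILITY AT THE GAPPED READING's OWN RATE FROM ANY WITNESS** (transfer; no estimate).  The cores `A − shA` here are the GAPPED cores: NO top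
cube statistic in the open collar, in either run — the single-run half of `T4IndicatorShell`'s design (i). [bookkeeping] -/
theorem core_crGap₁₃VAt (K₀ : ℕ) (jcut : ℕ → ℕ) (ρ : WidthLetter₁₃CoPH N) (n : DepthLetter₁₃CoPH N) (θ : Stage13HParams F N) (hP : θ.Provisos₁₃CoPH F N)
    (g₀ : ℕ → ℝ) (os : List (ULoop F)) {δ : ℕ → ℝ}
    (hP0 : letI : DecidableEq (Σ K, SiteSeqKey F (K₀ + K)) := Classical.decEq _
      ∀ (K : ℕ) (t : ℝ), |t| ≤ 1 → ∀ x ∈ classSet₁₃ θ K₀ g₀ K \ badClass₁₃ θ K₀ g₀ jcut K t,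
        0 ≤ gapWeightA₁₃ θ hP K₀ g₀ os (ρ F θ hP g₀ os) (n F θ hP g₀ os) K t x - gapShellA₁₃ θ hP K₀ g₀ os (ρ F θ hP g₀ os) (n F θ hP g₀ os) K t x)
    (h : letI : DecidableEq (Σ K, SiteSeqKey F (K₀ + K)) := Classical.decEq _
      NE7.Core 1 (F.side ^ 4) (classSet₁₃ θ K₀ g₀) (badClass₁₃ θ K₀ g₀ jcut)
        (fun K t x => gapWeightA₁₃ θ hP K₀ g₀ os (ρ F θ hP g₀ os) (n F θ hP g₀ os) K t x - gapShellA₁₃ θ hP K₀ g₀ os (ρ F θ hP g₀ os) (n F θ hP g₀ os) K t x)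
        (fun K t x => gapWeightB₁₃ θ hP K₀ g₀ os (ρ F θ hP g₀ os) (n F θ hP g₀ os) K t x - gapShellB₁₃ θ hP K₀ g₀ os (ρ F θ hP g₀ os) (n F θ hP g₀ os) K t x) δ)
    (hδ : Summable δ) :
    (letI := (crGap₁₃VAt N K₀ jcut ρ n F θ hP g₀ os).dec
     NE7.Core (crGap₁₃VAt N K₀ jcut ρ n F θ hP g₀ os).l₀ (crGap₁₃VAt N K₀ jcut ρ n F θ hP g₀ os).vol (crGap₁₃VAt N K₀ jcut ρ n F θ hP g₀ os).T
      (crGap₁₃VAt N K₀ jcut ρ n F θ hP g₀ os).Bad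
      (fun K t τ => (crGap₁₃VAt N K₀ jcut ρ n F θ hP g₀ os).A K t τ - (crGap₁₃VAt N K₀ jcut ρ n F θ hP g₀ os).shA K t τ)
      (fun K t τ => (crGap₁₃VAt N K₀ jcut ρ n F θ hP g₀ os).B K t τ - (crGap₁₃VAt N K₀ jcut ρ n F θ hP g₀ os).shB K t τ)
      (crGap₁₃VAt N K₀ jcut ρ n F θ hP g₀ os).δ) ∧ Summable (crGap₁₃VAt N K₀ jcut ρ n F θ hP g₀ os).δ := by
  letI : DecidableEq (Σ K, SiteSeqKey F (K₀ + K)) := Classical.decEq _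
  letI := (crGap₁₃VAt N K₀ jcut ρ n F θ hP g₀ os).dec
  exact ⟨core_deltaCan (pow_pos F.side_pos 4).le hP0 h, summable_deltaCan (pow_pos F.side_pos 4).le hP0 h hδ⟩

/-- **U4′'s `W + Wsh < 1` AT THE GAPPED READING FROM ANY WITNESSES** (transfer). [bookkeeping] -/
theorem lt_one_crGap₁₃VAt (K₀ : ℕ) (jcut : ℕ → ℕ) (ρ : WidthLetter₁₃CoPH N) (n : DepthLetter₁₃CoPH N) (θ : Stage13HParams F N) (hP : θ.Provisos₁₃CoPH F N)
    (g₀ : ℕ → ℝ) (os : List (ULoop F)) {W Wsh : ℕ → ℝ}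
    (hW : RelWeightBound 1 (classSet₁₃ θ K₀ g₀) (gapWeightA₁₃ θ hP K₀ g₀ os (ρ F θ hP g₀ os) (n F θ hP g₀ os))
      (gapWeightB₁₃ θ hP K₀ g₀ os (ρ F θ hP g₀ os) (n F θ hP g₀ os)) (badClass₁₃ θ K₀ g₀ jcut) W)
    (hSh : ShellWeightBound 1 (classSet₁₃ θ K₀ g₀) (gapWeightA₁₃ θ hP K₀ g₀ os (ρ F θ hP g₀ os) (n F θ hP g₀ os))
      (gapWeightB₁₃ θ hP K₀ g₀ os (ρ F θ hP g₀ os) (n F θ hP g₀ os)) (gapShellA₁₃ θ hP K₀ g₀ os (ρ F θ hP g₀ os) (n F θ hP g₀ os))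
      (gapShellB₁₃ θ hP K₀ g₀ os (ρ F θ hP g₀ os) (n F θ hP g₀ os)) Wsh)
    (hlt : ∀ K, W K + Wsh K < 1) (K : ℕ) :
    (crGap₁₃VAt N K₀ jcut ρ n F θ hP g₀ os).W K + (crGap₁₃VAt N K₀ jcut ρ n F θ hP g₀ os).Wsh K < 1 :=
  wInf_add_wshInf_lt_one hW hSh hlt K

/-- **THE THREE SELECTED LETTERS OF RUN A LIE IN THE WINDOW `[ε(1 − ρ_K)^{n+2}, ε]`** below print's `ε = ε_{K₀+K}`, ordered `θ_{i⋆+2} ≤ θ_{i⋆+1} ≤ θ_{i⋆}` (`0 ≤ ρ_K ≤ 1`, `0 ≤ ε`):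
the consumer's admissible-factor obligation ([LF-I] p.181) reads `(1 − ρ_K)^{n_K+2} ≥` its factor, jointly with `Σ_K 1∕(n_K+1) < ∞`. [bookkeeping] -/
theorem selGapLettersA_mem_window (K₀ : ℕ) (θ : Stage13HParams F N) (hP : θ.Provisos₁₃CoPH F N) (g₀ : ℕ → ℝ) (os : List (ULoop F)) {ρ : ℕ → ℝ}
    (hρ0 : ∀ K, 0 ≤ ρ K) (hρ1 : ∀ K, ρ K ≤ 1) (n K : ℕ) (t : ℝ) (hε : 0 ≤ epsOfRecord θ.ν (histA₁₃ θ K₀ g₀ K) (K₀ + K)) :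
    epsOfRecord θ.ν (histA₁₃ θ K₀ g₀ K) (K₀ + K) * (1 - ρ K) ^ (n + 2) ≤ cutGrid θ.ν (histA₁₃ θ K₀ g₀ K) (K₀ + K) (ρ K) (selGapDepth₁₃ θ hP K₀ g₀ os ρ n K t + 2) ∧
      cutGrid θ.ν (histA₁₃ θ K₀ g₀ K) (K₀ + K) (ρ K) (selGapDepth₁₃ θ hP K₀ g₀ os ρ n K t + 2) ≤
        cutGrid θ.ν (histA₁₃ θ K₀ g₀ K) (K₀ + K) (ρ K) (selGapDepth₁₃ θ hP K₀ g₀ os ρ n K t + 1) ∧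
      cutGrid θ.ν (histA₁₃ θ K₀ g₀ K) (K₀ + K) (ρ K) (selGapDepth₁₃ θ hP K₀ g₀ os ρ n K t + 1) ≤
        cutGrid θ.ν (histA₁₃ θ K₀ g₀ K) (K₀ + K) (ρ K) (selGapDepth₁₃ θ hP K₀ g₀ os ρ n K t) ∧
      cutGrid θ.ν (histA₁₃ θ K₀ g₀ K) (K₀ + K) (ρ K) (selGapDepth₁₃ θ hP K₀ g₀ os ρ n K t) ≤ epsOfRecord θ.ν (histA₁₃ θ K₀ g₀ K) (K₀ + K) := by
  refine ⟨?_, cutGrid_succ_le_of_nonneg θ.ν (K₀ + K) hε (hρ0 K) (hρ1 K) _, cutGrid_succ_le_of_nonneg θ.ν (K₀ + K) hε (hρ0 K) (hρ1 K) _, ?_⟩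
  · unfold cutGrid
    exact mul_le_mul_of_nonneg_left (pow_le_pow_of_le_one (by linarith [hρ0 K, hρ1 K]) (by linarith [hρ0 K, hρ1 K])
      (by have := selGapDepth₁₃_le θ hP K₀ g₀ os ρ n K t; omega)) hε
  · unfold cutGrid
    exact mul_le_of_le_one_right hε (pow_le_one₀ (by linarith [hρ0 K, hρ1 K]) (by linarith [hρ0 K, hρ1 K]))

/-- **THE THREE SELECTED LETTERS OF RUN B LIE IN THE WINDOW `[ε′(1 − ρ_K)^{n+2}, ε′]`** below print's `ε′ = ε_{K₀+K+1}` (same depth, same relative factors). [bookkeeping] -/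
theorem selGapLettersB_mem_window (K₀ : ℕ) (θ : Stage13HParams F N) (hP : θ.Provisos₁₃CoPH F N) (g₀ : ℕ → ℝ) (os : List (ULoop F)) {ρ : ℕ → ℝ}
    (hρ0 : ∀ K, 0 ≤ ρ K) (hρ1 : ∀ K, ρ K ≤ 1) (n K : ℕ) (t : ℝ) (hε : 0 ≤ epsOfRecord θ.ν (histB₁₃ θ K₀ g₀ K) (K₀ + K + 1)) :
    epsOfRecord θ.ν (histB₁₃ θ K₀ g₀ K) (K₀ + K + 1) * (1 - ρ K) ^ (n + 2) ≤
        cutGrid θ.ν (histB₁₃ θ K₀ g₀ K) (K₀ + K + 1) (ρ K) (selGapDepth₁₃ θ hP K₀ g₀ os ρ n K t + 2) ∧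
      cutGrid θ.ν (histB₁₃ θ K₀ g₀ K) (K₀ + K + 1) (ρ K) (selGapDepth₁₃ θ hP K₀ g₀ os ρ n K t + 2) ≤
        cutGrid θ.ν (histB₁₃ θ K₀ g₀ K) (K₀ + K + 1) (ρ K) (selGapDepth₁₃ θ hP K₀ g₀ os ρ n K t + 1) ∧
      cutGrid θ.ν (histB₁₃ θ K₀ g₀ K) (K₀ + K + 1) (ρ K) (selGapDepth₁₃ θ hP K₀ g₀ os ρ n K t + 1) ≤
        cutGrid θ.ν (histB₁₃ θ K₀ g₀ K) (K₀ + K + 1) (ρ K) (selGapDepth₁₃ θ hP K₀ g₀ os ρ n K t) ∧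
      cutGrid θ.ν (histB₁₃ θ K₀ g₀ K) (K₀ + K + 1) (ρ K) (selGapDepth₁₃ θ hP K₀ g₀ os ρ n K t) ≤ epsOfRecord θ.ν (histB₁₃ θ K₀ g₀ K) (K₀ + K + 1) := by
  refine ⟨?_, cutGrid_succ_le_of_nonneg θ.ν (K₀ + K + 1) hε (hρ0 K) (hρ1 K) _, cutGrid_succ_le_of_nonneg θ.ν (K₀ + K + 1) hε (hρ0 K) (hρ1 K) _, ?_⟩
  · unfold cutGrid
    exact mul_le_mul_of_nonneg_left (pow_le_pow_of_le_one (by linarith [hρ0 K, hρ1 K]) (by linarith [hρ0 K, hρ1 K])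
      (by have := selGapDepth₁₃_le θ hP K₀ g₀ os ρ n K t; omega)) hε
  · unfold cutGrid
    exact mul_le_of_le_one_right hε (pow_le_one₀ (by linarith [hρ0 K, hρ1 K]) (by linarith [hρ0 K, hρ1 K]))

/-- ★★ **THE K3 STUB-2 CONJUNCT `KeyedShellWeight` AT `crGap₁₃V`, IN THE SKELETON's ∀-SHAPE, MODULO THE DISPLAYED ROWS** (live-selector pin, (H-ζ), `0 ≤ ρ_K ≤ 1`, both tops'
`0 ≤ ε`, `Σ 1∕(n_K+1) < ∞`) — the record object `crGap₁₃V = crGap₁₃VAt N 0` (`rfl`); the pin a `PinnedAtLive` naming this reading would use. [bookkeeping] -/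
theorem keyedShellWeight_shape_crGap₁₃V_of_rows (jcut : ℕ → ℕ) (ρ : WidthLetter₁₃CoPH N) (n : DepthLetter₁₃CoPH N)
    (E : (F : T4Family) → Stage13HParams F N → (B12.RunParams → ℝ)) :
    ∀ (F : T4Family) (θ : Stage13HParams F N) (hP : θ.Provisos₁₃CoPH F N),
      θ.ppSel = ppSelLiveOfRecord F N θ.ν θ.τ9 (E F θ) (wOfRecord₉ F N θ.toStage9Params) → ZetaMeasurable F N θ.ζ →
      ∀ (g₀ : ℕ → ℝ) (os : List (ULoop F)), (∀ K, 0 ≤ ρ F θ hP g₀ os K) → (∀ K, ρ F θ hP g₀ os K ≤ 1) →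
        (∀ K, 0 ≤ epsOfRecord θ.ν (histA₁₃ θ 0 g₀ K) (0 + K)) → (∀ K, 0 ≤ epsOfRecord θ.ν (histB₁₃ θ 0 g₀ K) (0 + K + 1)) →
        Summable (fun K => 1 / ((n F θ hP g₀ os K : ℝ) + 1)) →
        ShellWeightBound (crGap₁₃V N jcut ρ n F θ hP g₀ os).l₀ (crGap₁₃V N jcut ρ n F θ hP g₀ os).T (crGap₁₃V N jcut ρ n F θ hP g₀ os).A
          (crGap₁₃V N jcut ρ n F θ hP g₀ os).B (crGap₁₃V N jcut ρ n F θ hP g₀ os).shA (crGap₁₃V N jcut ρ n F θ hP g₀ os).shB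
          (crGap₁₃V N jcut ρ n F θ hP g₀ os).Wsh :=
  fun F θ hP hsel hζm g₀ os hρ0 hρ1 hεA hεB hn => shellWeightBound_crGap₁₃VAt 0 jcut ρ n θ hP g₀ os (E F θ) hsel hζm hρ0 hρ1 hεA hεB hn

end AtReading

end Summit.QuantumFields.YangMills.Theorems.N21ShellSplitOfRecord13CoPH

end
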